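import Mathlib.Analysis.Fourier.PoissonSummation
import Mathlib.NumberTheory.ZetaValues
import Mathlib.Topology.Algebra.Field
import HarnessLib

/-!
# Poisson summation on a half-shifted lattice: fermionic Matsubara sums are alternating sums over images

Topic `Analysis/Fourier`; namespace `Literature.Analysis.Fourier`.  Mathlib's Poisson summation formula WITH the variable
(`Real.tsum_eq_tsum_fourier_of_rpow_decay_of_summable`: `Σ_n f(x + n) = Σ_m 𝓕f(m) e^{2πi m x}`, Stein–Weiss VII Cor. 2.6) at
`x = ½`, rescaled to a lattice of mesh `h > 0`:

* `fourier_comp_mul_left` — scaling `𝓕(F(h·))(ξ) = h⁻¹ 𝓕F(ξ/h)`; `fourier_mul_cexp_neg` — modulation `𝓕(e^{-iωτ}F)(ξ) = 𝓕F(ξ + τ/2π)`;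
* **`tsum_halfShift_eq_tsum_fourier`** — `Σ_{n ∈ ℤ} F(h(n + ½)) = h⁻¹ Σ_{m ∈ ℤ} (-1)^m 𝓕F(m/h)` and the unshifted twin
  `tsum_mesh_eq_tsum_fourier` — `Σ_n F(hn) = h⁻¹ Σ_m 𝓕F(m/h)` [cite: SteinWeiss1971, Ch. VII Cor. 2.6];
* **`fermionicMatsubaraSum_eq_tsum_images`** (`h = 2π/β`): for the FERMIONIC Matsubara frequencies `ω_n = (2n+1)π/β`
  (Benfatto–Giuliani–Mastropietro 2006 (2.3); Fetter–Walecka §25)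
  `(1/β) Σ_{n ∈ ℤ} e^{-iω_n τ} G(ω_n) = Σ_{m ∈ ℤ} (-1)^m ǧ(τ + mβ)`,  `ǧ(t) := (1/2π) ∫_ℝ G(ω) e^{-iωt} dω = (1/2π)·𝓕G(t/2π)`
  — the antiperiodic «sum over images in imaginary time» of the `β = ∞` transform (`bosonicMatsubaraSum_eq_tsum_images`: no signs,
  `ω_n = 2πn/β`);
* **`norm_fermionicMatsubaraSum_sub_nearestImages_le`** — if moreover `‖𝓕G(t/2π)‖ ≤ A/t²` for `t ≠ 0` (i.e. `|ǧ(t)| ≤ A/(2π t²)`),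
  then for `τ ∈ [0, β]` the two NEAREST images are the main terms and the rest is `O(β^{-2})`:
  `‖(1/β) Σ_n e^{-iω_nτ} G(ω_n) - (1/2π)(𝓕G(τ/2π) - 𝓕G((τ-β)/2π))‖ ≤ A·π/(6β²)`  (`Σ_{m≥1} m^{-2} = π²/6` twice; in the `ǧ`-normalisation
  `|ǧ| ≤ A'/t²` this reads `≤ A'·π²/(3β²)`).  (Docstring corrected 2026-08-28, referee ref-5 R5-18 NIT-1: decl name and normalisation.)

Hypotheses are the power-law ones of Mathlib's Poisson formula: `G` continuous, `G = O(|ω|^{-b})` at infinity for some `b > 1`, and the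
relevant samples of `𝓕G` absolutely summable (automatic from `ǧ = O(|t|^{-b})`: `summable_images_of_isBigO`).  This is the shape of an
off-site UV-cutoff propagator (`|Ψ̂(ω)| ≲ 1/ω²` at large frequency, `|ǧ(t)| ≲ V₂/t²` from two `ω`-derivatives).

Everything is proved; no definitions, no named facts.  Not here: bounds on `ǧ` itself (Abel/strip/Gevrey envelopes), any propagator.

## Mathlib / tree search

Mathlib: `Real.tsum_eq_tsum_fourier_of_rpow_decay[_of_summable]`, `Real.fourier_real_eq_integral_exp_smul`, `hasSum_zeta_two`,
`HasSum.of_nat_of_neg_add_one`, `Filter.tendsto_cocompact_mul_left₀`.  Tree: `Analysis/Fourier/PoissonSummationPeriodization`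
(Grafakos Thm 3.2.8, lattices in euclidean spaces), `Analysis/Quadrature/TrapezoidalRuleRealLine` (Trefethen–Weideman Thm 5.1, uses the
same scaling privately), `Probability/LatticeModels/DiscretePoissonSummation` (finite groups); the half-shifted / Matsubara form with the
`(-1)^m` images and the `O(β^{-2})` tail was absent (`rg 'antiperiodic|\(2 \* n \+ 1\) \* π' Literature`).

## References

* E. M. Stein, G. Weiss, *Introduction to Fourier Analysis on Euclidean Spaces* (1971), Ch. VII, Cor. 2.6. [SteinWeiss1971]
* A. L. Fetter, J. D. Walecka, *Quantum Theory of Many-Particle Systems* (1971), Ch. 7 §25 (frequency sums; antiperiodicity of the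
  temperature Green's function). [FetterWalecka1971]
* G. Benfatto, A. Giuliani, V. Mastropietro, Ann. Henri Poincaré 7 (2006) 809–898, §2.1 (2.3)–(2.4) (`k₀ = 2π(n₀ + ½)/β`). [BenfattoGiulianiMastropietro2006]
-/

noncomputable section

open MeasureTheory Complex Filter Asymptotics Topology
open scoped FourierTransform Real

namespace Literature.Analysis.Fourier

/-! ### §1 Scaling and modulation of the Fourier transform on `ℝ` -/

/-- **Scaling**: `𝓕(x ↦ F(hx))(ξ) = h⁻¹·𝓕F(ξ/h)` for `h > 0`. [cite: SteinWeiss1971, Ch. I Thm. 1.3] -/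
theorem fourier_comp_mul_left (F : ℝ → ℂ) {h : ℝ} (hh : 0 < h) (ξ : ℝ) :
    𝓕 (fun x : ℝ => F (h * x)) ξ = ((h⁻¹ : ℝ) : ℂ) * 𝓕 F (ξ / h) := by
  rw [Real.fourier_real_eq_integral_exp_smul, Real.fourier_real_eq_integral_exp_smul]
  have e : (fun v : ℝ => cexp (↑(-2 * π * v * ξ) * I) • F (h * v)) =
      fun v : ℝ => (fun u : ℝ => cexp (↑(-2 * π * u * (ξ / h)) * I) • F u) (h * v) := by
    funext v
    simp only [smul_eq_mul]
    have : (-2 * π * v * ξ : ℝ) = -2 * π * (h * v) * (ξ / h) := by field_simp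
    rw [this]
  rw [e, Measure.integral_comp_mul_left (fun u : ℝ => cexp (↑(-2 * π * u * (ξ / h)) * I) • F u) h,
    abs_of_pos (inv_pos.mpr hh), Complex.real_smul]

/-- **Modulation**: `𝓕(ω ↦ e^{-iωτ} F(ω))(ξ) = 𝓕F(ξ + τ/(2π))`. [cite: SteinWeiss1971, Ch. I Thm. 1.3] -/
theorem fourier_mul_cexp_neg (F : ℝ → ℂ) (τ ξ : ℝ) :
    𝓕 (fun ω : ℝ => cexp (-(I * ω * τ)) * F ω) ξ = 𝓕 F (ξ + τ / (2 * π)) := by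
  rw [Real.fourier_real_eq_integral_exp_smul, Real.fourier_real_eq_integral_exp_smul]
  congr 1
  funext v
  simp only [smul_eq_mul, ← mul_assoc]
  congr 1
  rw [← Complex.exp_add]
  congr 1
  have hπ : (π : ℂ) ≠ 0 := by exact_mod_cast Real.pi_ne_zero
  push_cast
  field_simp
  ring

/-! ### §2 Poisson summation on the mesh `hℤ` and on the half-shifted mesh `h(ℤ + ½)` -/

/-- Decay is preserved under the homothety `x ↦ hx`. [folklore] -/
private theorem isBigO_comp_mul {F : ℝ → ℂ} {b h : ℝ} (hh : 0 < h) (hF : F =O[cocompact ℝ] fun x : ℝ => |x| ^ (-b)) :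
    (fun x : ℝ => F (h * x)) =O[cocompact ℝ] fun x : ℝ => |x| ^ (-b) := by
  have h1 : (fun x : ℝ => F (h * x)) =O[cocompact ℝ] fun x : ℝ => |h * x| ^ (-b) :=
    hF.comp_tendsto (Filter.tendsto_cocompact_mul_left₀ hh.ne')
  refine h1.trans (IsBigO.of_bound (|h| ^ (-b)) (Eventually.of_forall fun x => ?_))
  rw [abs_mul, Real.mul_rpow (abs_nonneg _) (abs_nonneg _), Real.norm_of_nonneg (by positivity),
    Real.norm_of_nonneg (by positivity)]

/-- `e^{2πi m·½} = (-1)^m`. [folklore] -/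
private theorem fourier_coe_half (m : ℤ) : fourier m (((1 / 2 : ℝ)) : UnitAddCircle) = (-1 : ℂ) ^ m := by
  rw [fourier_coe_apply, ← Complex.exp_pi_mul_I, ← Complex.exp_int_mul]
  congr 1
  push_cast
  ring

/-- **Poisson summation on the mesh `hℤ`**: for `F` continuous with `F = O(|x|^{-b})` (`b > 1`) and `Σ_m |𝓕F(m/h)| < ∞`,
`Σ_{n ∈ ℤ} F(hn) = h⁻¹ Σ_{m ∈ ℤ} 𝓕F(m/h)`. [cite: SteinWeiss1971, Ch. VII Cor. 2.6] -/
theorem tsum_mesh_eq_tsum_fourier {F : ℝ → ℂ} (hc : Continuous F) {b : ℝ} (hb : 1 < b)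
    (hF : F =O[cocompact ℝ] fun x : ℝ => |x| ^ (-b)) {h : ℝ} (hh : 0 < h)
    (hsum : Summable fun m : ℤ => 𝓕 F (m / h)) :
    ∑' n : ℤ, F (h * n) = ((h⁻¹ : ℝ) : ℂ) * ∑' m : ℤ, 𝓕 F (m / h) := by
  have hs' : Summable fun m : ℤ => 𝓕 (fun x : ℝ => F (h * x)) m := by
    simp_rw [fourier_comp_mul_left F hh]
    exact hsum.mul_left _
  have key := Real.tsum_eq_tsum_fourier_of_rpow_decay_of_summable (f := fun x : ℝ => F (h * x)) (by fun_prop)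
    hb (isBigO_comp_mul hh hF) hs' 0
  simp only [zero_add, QuotientAddGroup.mk_zero, fourier_eval_zero, mul_one] at key
  rw [key, ← tsum_mul_left]
  exact tsum_congr fun m => by rw [fourier_comp_mul_left F hh]

/-- **Poisson summation on the half-shifted mesh `h(ℤ + ½)`**: for `F` continuous with `F = O(|x|^{-b})` (`b > 1`) and
`Σ_m |𝓕F(m/h)| < ∞`, `Σ_{n ∈ ℤ} F(h(n + ½)) = h⁻¹ Σ_{m ∈ ℤ} (-1)^m 𝓕F(m/h)` — the shift by half a mesh makes the images ALTERNATE.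
[cite: SteinWeiss1971, Ch. VII Cor. 2.6] -/
theorem tsum_halfShift_eq_tsum_fourier {F : ℝ → ℂ} (hc : Continuous F) {b : ℝ} (hb : 1 < b)
    (hF : F =O[cocompact ℝ] fun x : ℝ => |x| ^ (-b)) {h : ℝ} (hh : 0 < h)
    (hsum : Summable fun m : ℤ => 𝓕 F (m / h)) :
    ∑' n : ℤ, F (h * (n + 1 / 2)) = ((h⁻¹ : ℝ) : ℂ) * ∑' m : ℤ, (-1 : ℂ) ^ m * 𝓕 F (m / h) := by
  have hs' : Summable fun m : ℤ => 𝓕 (fun x : ℝ => F (h * x)) m := by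
    simp_rw [fourier_comp_mul_left F hh]
    exact hsum.mul_left _
  have key := Real.tsum_eq_tsum_fourier_of_rpow_decay_of_summable (f := fun x : ℝ => F (h * x)) (by fun_prop)
    hb (isBigO_comp_mul hh hF) hs' (1 / 2)
  have lhs : (fun n : ℤ => F (h * (n + 1 / 2))) = fun n : ℤ => (fun x : ℝ => F (h * x)) (1 / 2 + n) := by
    funext n; simp only [add_comm]
  rw [lhs, key, ← tsum_mul_left]
  refine tsum_congr fun m => ?_
  rw [fourier_comp_mul_left F hh, fourier_coe_half]
  ring

/-! ### §3 Matsubara sums: fermionic `ω_n = (2n+1)π/β` and bosonic `ω_n = 2πn/β` -/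

/-- The inverse transform in the physicists' normalisation: `𝓕G(t/2π) = ∫_ℝ G(ω) e^{-iωt} dω`, so that
`ǧ(t) := (1/2π)∫G(ω)e^{-iωt}dω = (1/2π)·𝓕G(t/2π)`. [cite: FetterWalecka1971, Ch. 7 §25] -/
theorem fourier_apply_div_two_pi (G : ℝ → ℂ) (t : ℝ) :
    𝓕 G (t / (2 * π)) = ∫ ω : ℝ, cexp (-(I * ω * t)) * G ω := by
  rw [Real.fourier_real_eq_integral_exp_smul]
  congr 1
  funext ω
  rw [smul_eq_mul]
  congr 1
  have hπ : (π : ℂ) ≠ 0 := by exact_mod_cast Real.pi_ne_zero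
  push_cast
  field_simp

/-- **Fermionic Matsubara sum = alternating sum over images** (frequency form): with `ω_n = (2n+1)π/β`, `β > 0`,
`(1/β) Σ_{n ∈ ℤ} G(ω_n) = (1/2π) Σ_{m ∈ ℤ} (-1)^m 𝓕G(mβ/2π) = Σ_m (-1)^m ǧ(mβ)`. [cite: FetterWalecka1971, Ch. 7 §25] -/
theorem fermionicMatsubaraSum_eq_tsum_fourier {G : ℝ → ℂ} (hc : Continuous G) {b : ℝ} (hb : 1 < b)
    (hG : G =O[cocompact ℝ] fun x : ℝ => |x| ^ (-b)) {β : ℝ} (hβ : 0 < β)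
    (hsum : Summable fun m : ℤ => 𝓕 G (m * β / (2 * π))) :
    ((1 / β : ℝ) : ℂ) * ∑' n : ℤ, G ((2 * n + 1) * π / β) =
      ((1 / (2 * π) : ℝ) : ℂ) * ∑' m : ℤ, (-1 : ℂ) ^ m * 𝓕 G (m * β / (2 * π)) := by
  have hh : 0 < 2 * π / β := by positivity
  have hmesh : ∀ m : ℤ, (m : ℝ) / (2 * π / β) = m * β / (2 * π) := fun m => by
    field_simp
  have hsum' : Summable fun m : ℤ => 𝓕 G (m / (2 * π / β)) := by simpa only [hmesh] using hsum
  have key := tsum_halfShift_eq_tsum_fourier hc hb hG hh hsum'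
  have lhs : (fun n : ℤ => G (2 * π / β * (n + 1 / 2))) = fun n : ℤ => G ((2 * n + 1) * π / β) := by
    funext n; congr 1; field_simp
  rw [lhs] at key
  have hβ0 : (β : ℂ) ≠ 0 := by exact_mod_cast hβ.ne'
  have hπ0 : (π : ℂ) ≠ 0 := by exact_mod_cast Real.pi_ne_zero
  rw [key, ← mul_assoc]
  simp_rw [hmesh]
  congr 1
  push_cast
  field_simp

/-- **Bosonic Matsubara sum = sum over images** (frequency form): with `ω_n = 2πn/β`,
`(1/β) Σ_{n ∈ ℤ} G(ω_n) = (1/2π) Σ_{m ∈ ℤ} 𝓕G(mβ/2π)`. [cite: FetterWalecka1971, Ch. 7 §25] -/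
theorem bosonicMatsubaraSum_eq_tsum_fourier {G : ℝ → ℂ} (hc : Continuous G) {b : ℝ} (hb : 1 < b)
    (hG : G =O[cocompact ℝ] fun x : ℝ => |x| ^ (-b)) {β : ℝ} (hβ : 0 < β)
    (hsum : Summable fun m : ℤ => 𝓕 G (m * β / (2 * π))) :
    ((1 / β : ℝ) : ℂ) * ∑' n : ℤ, G (2 * π * n / β) =
      ((1 / (2 * π) : ℝ) : ℂ) * ∑' m : ℤ, 𝓕 G (m * β / (2 * π)) := by
  have hh : 0 < 2 * π / β := by positivity
  have hmesh : ∀ m : ℤ, (m : ℝ) / (2 * π / β) = m * β / (2 * π) := fun m => by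
    field_simp
  have hsum' : Summable fun m : ℤ => 𝓕 G (m / (2 * π / β)) := by simpa only [hmesh] using hsum
  have key := tsum_mesh_eq_tsum_fourier hc hb hG hh hsum'
  have lhs : (fun n : ℤ => G (2 * π / β * n)) = fun n : ℤ => G (2 * π * n / β) := by
    funext n; congr 1; field_simp
  rw [lhs] at key
  have hβ0 : (β : ℂ) ≠ 0 := by exact_mod_cast hβ.ne'
  have hπ0 : (π : ℂ) ≠ 0 := by exact_mod_cast Real.pi_ne_zero
  rw [key, ← mul_assoc]
  simp_rw [hmesh]
  congr 1
  push_cast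
  field_simp

/-! ### §4 The time-dependent form: `(1/β) Σ_n e^{-iω_nτ} G(ω_n) = Σ_m (-1)^m ǧ(τ + mβ)` -/

/-- Continuity of the modulated function `ω ↦ e^{-iωτ} G(ω)`. [folklore] -/
private theorem continuous_mul_cexp_neg {G : ℝ → ℂ} (hc : Continuous G) (τ : ℝ) :
    Continuous fun ω : ℝ => cexp (-(I * ω * τ)) * G ω := by
  fun_prop

/-- The modulation does not change the size: `e^{-iωτ}G = O(|ω|^{-b})` iff `G` is. [folklore] -/
private theorem isBigO_mul_cexp_neg {G : ℝ → ℂ} {b : ℝ} (hG : G =O[cocompact ℝ] fun x : ℝ => |x| ^ (-b)) (τ : ℝ) :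
    (fun ω : ℝ => cexp (-(I * ω * τ)) * G ω) =O[cocompact ℝ] fun x : ℝ => |x| ^ (-b) := by
  refine (IsBigO.of_bound 1 (Eventually.of_forall fun ω => ?_)).trans hG
  rw [norm_mul, one_mul]
  have : ‖cexp (-(I * ω * τ))‖ = 1 := by
    rw [Complex.norm_exp]
    simp
  rw [this, one_mul]

/-- **Fermionic Matsubara sum = alternating sum over images in imaginary time**: for `G` continuous with `G = O(|ω|^{-b})`
(`b > 1`), `β > 0`, `τ ∈ ℝ`, and `Σ_m |𝓕G((mβ + τ)/2π)| < ∞`,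
`(1/β) Σ_{n ∈ ℤ} e^{-iω_nτ} G(ω_n) = (1/2π) Σ_{m ∈ ℤ} (-1)^m 𝓕G((τ + mβ)/2π) = Σ_m (-1)^m ǧ(τ + mβ)`, `ω_n = (2n+1)π/β`,
`ǧ(t) = (1/2π)∫G(ω)e^{-iωt}dω` (`fourier_apply_div_two_pi`) — the `β`-periodised (antiperiodic) kernel is the alternating sum of
the `β = ∞` kernel over the images `τ + mβ`. [cite: FetterWalecka1971, Ch. 7 §25] -/
theorem fermionicMatsubaraSum_eq_tsum_images {G : ℝ → ℂ} (hc : Continuous G) {b : ℝ} (hb : 1 < b)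
    (hG : G =O[cocompact ℝ] fun x : ℝ => |x| ^ (-b)) {β : ℝ} (hβ : 0 < β) (τ : ℝ)
    (hsum : Summable fun m : ℤ => 𝓕 G ((m * β + τ) / (2 * π))) :
    ((1 / β : ℝ) : ℂ) * ∑' n : ℤ, cexp (-(I * (((2 * n + 1) * π / β : ℝ) : ℂ) * τ)) * G ((2 * n + 1) * π / β) =
      ((1 / (2 * π) : ℝ) : ℂ) * ∑' m : ℤ, (-1 : ℂ) ^ m * 𝓕 G ((m * β + τ) / (2 * π)) := by
  have hmod : ∀ m : ℤ, 𝓕 (fun ω : ℝ => cexp (-(I * ω * τ)) * G ω) (m * β / (2 * π)) = 𝓕 G ((m * β + τ) / (2 * π)) := by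
    intro m
    rw [fourier_mul_cexp_neg, add_div]
  have hsum' : Summable fun m : ℤ => 𝓕 (fun ω : ℝ => cexp (-(I * ω * τ)) * G ω) (m * β / (2 * π)) := by
    simpa only [hmod] using hsum
  have key := fermionicMatsubaraSum_eq_tsum_fourier (continuous_mul_cexp_neg hc τ) hb (isBigO_mul_cexp_neg hG τ) hβ hsum'
  simp only [hmod] at key
  simpa only [Complex.ofReal_div, Complex.ofReal_mul, Complex.ofReal_add, Complex.ofReal_one, Complex.ofReal_intCast,
    Complex.ofReal_ofNat] using key

/-- **Bosonic twin**: `(1/β) Σ_{n ∈ ℤ} e^{-iω_nτ} G(ω_n) = (1/2π) Σ_m 𝓕G((τ + mβ)/2π) = Σ_m ǧ(τ + mβ)`, `ω_n = 2πn/β`.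
[cite: FetterWalecka1971, Ch. 7 §25] -/
theorem bosonicMatsubaraSum_eq_tsum_images {G : ℝ → ℂ} (hc : Continuous G) {b : ℝ} (hb : 1 < b)
    (hG : G =O[cocompact ℝ] fun x : ℝ => |x| ^ (-b)) {β : ℝ} (hβ : 0 < β) (τ : ℝ)
    (hsum : Summable fun m : ℤ => 𝓕 G ((m * β + τ) / (2 * π))) :
    ((1 / β : ℝ) : ℂ) * ∑' n : ℤ, cexp (-(I * (((2 * π * n / β : ℝ)) : ℂ) * τ)) * G (2 * π * n / β) =
      ((1 / (2 * π) : ℝ) : ℂ) * ∑' m : ℤ, 𝓕 G ((m * β + τ) / (2 * π)) := by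
  have hmod : ∀ m : ℤ, 𝓕 (fun ω : ℝ => cexp (-(I * ω * τ)) * G ω) (m * β / (2 * π)) = 𝓕 G ((m * β + τ) / (2 * π)) := by
    intro m
    rw [fourier_mul_cexp_neg, add_div]
  have hsum' : Summable fun m : ℤ => 𝓕 (fun ω : ℝ => cexp (-(I * ω * τ)) * G ω) (m * β / (2 * π)) := by
    simpa only [hmod] using hsum
  have key := bosonicMatsubaraSum_eq_tsum_fourier (continuous_mul_cexp_neg hc τ) hb (isBigO_mul_cexp_neg hG τ) hβ hsum'
  simp only [hmod] at key
  simpa only [Complex.ofReal_div, Complex.ofReal_mul, Complex.ofReal_one, Complex.ofReal_intCast, Complex.ofReal_ofNat] using key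

/-! ### §5 Quadratic decay of `ǧ`: summability of the images and the `O(β^{-2})` tail beyond the two nearest images -/

/-- The majorant of the far images: `g(m) = (A/β²)/max(m, -m-1)²` (`= 0` at `m = 0, -1`, the two nearest images); its sum is
`2·(A/β²)·ζ(2)` (Mathlib `hasSum_zeta_two`). [folklore] -/
private theorem hasSum_farImages_majorant (A β : ℝ) :
    HasSum (fun m : ℤ => A / β ^ 2 * (1 / ((max m (-m - 1) : ℤ) : ℝ) ^ 2)) (A / β ^ 2 * (π ^ 2 / 6) + A / β ^ 2 * (π ^ 2 / 6)) := by
  refine HasSum.of_nat_of_neg_add_one ?_ ?_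
  · have h := (hasSum_zeta_two.mul_left (A / β ^ 2))
    refine h.congr_fun fun n => ?_
    congr 3
    rw [max_eq_left (by omega)]
    simp
  · have h := (hasSum_zeta_two.mul_left (A / β ^ 2))
    refine h.congr_fun fun n => ?_
    congr 3
    rw [max_eq_right (by omega)]
    push_cast
    ring

/-- Far images are far: for `τ ∈ [0, β]` and `m ∉ {0, -1}`, `|mβ + τ| ≥ β·max(m, -m-1) > 0`. [folklore] -/
private theorem beta_mul_max_le_abs {β τ : ℝ} (hβ : 0 < β) (hτ0 : 0 ≤ τ) (hτβ : τ ≤ β) (m : ℤ) :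
    β * ((max m (-m - 1) : ℤ) : ℝ) ≤ |m * β + τ| := by
  rcases le_or_gt 0 m with hm | hm
  · rw [max_eq_left (by omega)]
    have : (0 : ℝ) ≤ m := by exact_mod_cast hm
    rw [abs_of_nonneg (by positivity)]
    nlinarith
  · rw [max_eq_right (by omega)]
    have hm' : (m : ℝ) ≤ -1 := by exact_mod_cast (show m ≤ -1 by omega)
    push_cast
    rw [abs_of_nonpos (by nlinarith)]
    nlinarith

/-- **Summability of the images from quadratic decay**: if `‖𝓕G(t/2π)‖ ≤ A/t²` for `t ≠ 0` then `Σ_m |𝓕G((mβ+τ)/2π)| < ∞` for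
`β > 0`, `τ ∈ [0, β]`. [cite: SteinWeiss1971, Ch. VII Cor. 2.6] -/
theorem summable_images_of_sq_decay {G : ℝ → ℂ} {A β τ : ℝ} (hβ : 0 < β) (hτ0 : 0 ≤ τ) (hτβ : τ ≤ β)
    (hA : ∀ t : ℝ, t ≠ 0 → ‖𝓕 G (t / (2 * π))‖ ≤ A / t ^ 2) :
    Summable fun m : ℤ => 𝓕 G ((m * β + τ) / (2 * π)) := by
  refine Summable.of_norm_bounded_eventually (hasSum_farImages_majorant A β).summable ?_
  have hfin : {m : ℤ | m = 0 ∨ m = -1}ᶜ ∈ (cofinite : Filter ℤ) := by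
    rw [mem_cofinite, compl_compl]
    exact ((Set.finite_singleton (-1 : ℤ)).insert 0).subset fun m hm => by
      rcases hm with h | h <;> simp [h]
  filter_upwards [hfin] with m hm
  simp only [Set.mem_compl_iff, Set.mem_setOf_eq, not_or] at hm
  have hmax : (0 : ℝ) < ((max m (-m - 1) : ℤ) : ℝ) := by
    have : 0 < max m (-m - 1) := by rcases le_or_gt 0 m with h | h <;> [exact lt_max_of_lt_left (by omega); exact lt_max_of_lt_right (by omega)]
    exact_mod_cast this
  have hfar := beta_mul_max_le_abs hβ hτ0 hτβ m
  have ht : (m : ℝ) * β + τ ≠ 0 := fun h => by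
    rw [h, abs_zero] at hfar
    nlinarith
  calc ‖𝓕 G ((m * β + τ) / (2 * π))‖ ≤ A / (m * β + τ) ^ 2 := hA _ ht
    _ ≤ A / (β * ((max m (-m - 1) : ℤ) : ℝ)) ^ 2 := by
        have hA0 : 0 ≤ A := by
          by_contra hneg
          rw [not_le] at hneg
          have hlt : A / ((m : ℝ) * β + τ) ^ 2 < 0 := div_neg_of_neg_of_pos hneg (by positivity)
          linarith [norm_nonneg (𝓕 G ((m * β + τ) / (2 * π))), hA _ ht]
        rw [← sq_abs ((m : ℝ) * β + τ)]
        exact div_le_div_of_nonneg_left hA0 (by positivity) (pow_le_pow_left₀ (by positivity) hfar 2)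
    _ = A / β ^ 2 * (1 / ((max m (-m - 1) : ℤ) : ℝ) ^ 2) := by
        rw [mul_pow]
        field_simp

/-- **The two nearest images carry the sum up to `O(β^{-2})`**: if `G` is continuous, `G = O(|ω|^{-b})` (`b > 1`), and
`‖𝓕G(t/2π)‖ ≤ A/t²` for `t ≠ 0` (i.e. `|ǧ(t)| ≤ A/(2π t²)`), then for `β > 0` and `τ ∈ [0, β]`
`‖(1/β) Σ_n e^{-iω_nτ} G(ω_n) - (1/2π)(𝓕G(τ/2π) - 𝓕G((τ-β)/2π))‖ ≤ A·π/(6β²)`, i.e.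
`C_β(τ) = ǧ(τ) - ǧ(τ - β) + O(A/β²)`: the images `m ≥ 1` and `m ≤ -2` sit at distance `≥ mβ`, `≥ (|m|-1)β` and sum to
`2·(A/2π)·ζ(2)/β²`. [cite: FetterWalecka1971, Ch. 7 §25] -/
theorem norm_fermionicMatsubaraSum_sub_nearestImages_le {G : ℝ → ℂ} (hc : Continuous G) {b : ℝ} (hb : 1 < b)
    (hG : G =O[cocompact ℝ] fun x : ℝ => |x| ^ (-b)) {β : ℝ} (hβ : 0 < β) {τ : ℝ} (hτ0 : 0 ≤ τ) (hτβ : τ ≤ β)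
    {A : ℝ} (hA : ∀ t : ℝ, t ≠ 0 → ‖𝓕 G (t / (2 * π))‖ ≤ A / t ^ 2) :
    ‖((1 / β : ℝ) : ℂ) * ∑' n : ℤ, cexp (-(I * (((2 * n + 1) * π / β : ℝ) : ℂ) * τ)) * G ((2 * n + 1) * π / β) -
        ((1 / (2 * π) : ℝ) : ℂ) * (𝓕 G (τ / (2 * π)) - 𝓕 G ((τ - β) / (2 * π)))‖ ≤ A * π / (6 * β ^ 2) := by
  have hsum := summable_images_of_sq_decay hβ hτ0 hτβ hA
  rw [fermionicMatsubaraSum_eq_tsum_images hc hb hG hβ τ hsum]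
  -- the images `m = 0` and `m = -1` are the two main terms
  set u : ℤ → ℂ := fun m => (-1 : ℂ) ^ m * 𝓕 G ((m * β + τ) / (2 * π)) with hu
  have hus : Summable u := by
    refine Summable.of_norm_bounded_eventually (g := fun m => ‖𝓕 G ((m * β + τ) / (2 * π))‖) hsum.norm
      (Eventually.of_forall fun m => ?_)
    rw [hu, norm_mul, norm_zpow, norm_neg, norm_one, one_zpow, one_mul]
  have h0 : u 0 = 𝓕 G (τ / (2 * π)) := by simp [hu]
  have h1 : u (-1) = -𝓕 G ((τ - β) / (2 * π)) := by
    simp only [hu, Int.reduceNeg, zpow_neg, zpow_one, Int.cast_neg, Int.cast_one, neg_mul, one_mul]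
    rw [inv_neg, inv_one, neg_one_mul, neg_add_eq_sub]
  -- remove the two main terms
  set w : ℤ → ℂ := fun m => if m = 0 ∨ m = -1 then 0 else u m with hw
  have hwsum : HasSum w (∑' m, u m - u 0 - u (-1)) := by
    have h := (hus.hasSum.sub (hasSum_ite_eq (0 : ℤ) (u 0))).sub (hasSum_ite_eq (-1 : ℤ) (u (-1)))
    refine h.congr_fun fun m => ?_
    simp only [hw]
    by_cases hm0 : m = 0
    · subst hm0; simp
    · by_cases hm1 : m = -1
      · subst hm1; simp
      · simp [hm0, hm1]
  -- bound the far images by the majorant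
  have hbound : ∀ m : ℤ, ‖w m‖ ≤ A / β ^ 2 * (1 / ((max m (-m - 1) : ℤ) : ℝ) ^ 2) := by
    intro m
    by_cases hm : m = 0 ∨ m = -1
    · rw [hw]; simp only [hm, if_true, norm_zero]
      rcases hm with h | h <;> subst h <;> simp
    · rw [hw]; simp only [hm, if_false]
      rw [hu]; simp only []
      rw [norm_mul, norm_zpow, norm_neg, norm_one, one_zpow, one_mul]
      rw [not_or] at hm
      have hfar := beta_mul_max_le_abs hβ hτ0 hτβ m
      have hmax : (0 : ℝ) < ((max m (-m - 1) : ℤ) : ℝ) := by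
        have : 0 < max m (-m - 1) := by
          rcases le_or_gt 0 m with h | h <;> [exact lt_max_of_lt_left (by omega); exact lt_max_of_lt_right (by omega)]
        exact_mod_cast this
      have ht : (m : ℝ) * β + τ ≠ 0 := fun h => by
        rw [h, abs_zero] at hfar
        nlinarith
      have hAt := hA _ ht
      have hA0 : 0 ≤ A := by
        by_contra hneg
        rw [not_le] at hneg
        have hlt : A / ((m : ℝ) * β + τ) ^ 2 < 0 := div_neg_of_neg_of_pos hneg (by positivity)
        linarith [norm_nonneg (𝓕 G ((m * β + τ) / (2 * π)))]
      calc ‖𝓕 G ((m * β + τ) / (2 * π))‖ ≤ A / (m * β + τ) ^ 2 := hAt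
        _ ≤ A / (β * ((max m (-m - 1) : ℤ) : ℝ)) ^ 2 := by
            rw [← sq_abs ((m : ℝ) * β + τ)]
            exact div_le_div_of_nonneg_left hA0 (by positivity) (pow_le_pow_left₀ (by positivity) hfar 2)
        _ = A / β ^ 2 * (1 / ((max m (-m - 1) : ℤ) : ℝ) ^ 2) := by rw [mul_pow]; field_simp
  have htail : ‖∑' m, u m - u 0 - u (-1)‖ ≤ A / β ^ 2 * (π ^ 2 / 6) + A / β ^ 2 * (π ^ 2 / 6) := by
    rw [← hwsum.tsum_eq]
    exact tsum_of_norm_bounded (hasSum_farImages_majorant A β) hbound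
  -- assemble
  have hπ : 0 < π := Real.pi_pos
  have hexpr : ((1 / (2 * π) : ℝ) : ℂ) * ∑' m : ℤ, u m - ((1 / (2 * π) : ℝ) : ℂ) * (𝓕 G (τ / (2 * π)) - 𝓕 G ((τ - β) / (2 * π))) =
      ((1 / (2 * π) : ℝ) : ℂ) * (∑' m, u m - u 0 - u (-1)) := by
    rw [h0, h1]; ring
  rw [hexpr, norm_mul, Complex.norm_real, Real.norm_of_nonneg (by positivity)]
  calc 1 / (2 * π) * ‖∑' m, u m - u 0 - u (-1)‖ ≤ 1 / (2 * π) * (A / β ^ 2 * (π ^ 2 / 6) + A / β ^ 2 * (π ^ 2 / 6)) :=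
        mul_le_mul_of_nonneg_left htail (by positivity)
    _ = A * π / (6 * β ^ 2) := by field_simp; ring

end Literature.Analysis.Fourier

end
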